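import Summits.BirchSwinnertonDyer.BirchSwinnertonDyer.Theorems.PrintCf2SplitBadTwoKummerBranchInputs
import Literature.NumberTheory.EllipticCurves.MordellWeilTheoremProofs
import HarnessLib

/-!
# Crux `PrintCf2.SplitBadTwoRankOneOfFacts` (stmt-BirchSwinnertonDyer-20368), road α v10.3, S3c residual (R-BV), input (H1′) — file 4 of
# the branch argument: the arithmetic input (IND) FROM MORDELL–WEIL, and (H1′) ⟸ `hfinB′` ∧ (T-loc) alone

Cell `bsd-print-cf2`, EXTRA WIDTH seat `bsd-line-cf2-p1-w3` g9 (prover-bsd-line-cf2-p1-w3-g9-0); `--supports stmt-BirchSwinnertonDyer-20368`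
(helper, Theses-free). HONEST FRAMING: nothing here closes the crux or a registered stub; BSD is not proved by any of this; no summit statement
is proved by this seat. No definition, no named fact, no `sorry`, no kit. beyond-print theorem: no.

WHAT. p672752 reduced (H1′) «`ι_*⁻¹(res_⊤ range κ) ≤ ker loc_v`» to `hfinB′`, the local cyclicity (T-loc), `IsUnit (r − r′)` and the arithmetic
statement (IND) «for every `m` some Kummer class `κ_N(w • (π(p^m P₁) − N₂ • p^m P₁))` is non-zero». THIS FILE proves (IND) for ANY `K`-point
`P₀` of infinite order and ANY `π ∈ End_K(E)` with `π² = π − 2`, from the MORDELL–WEIL THEOREM (tree theorem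
`WeierstrassCurve.module_finite_point_holds`: `E(K)/tors` is a free finitely generated `ℤ`-module):
* §1 INDEPENDENCE `eq_zero_of_nsmul_zsmul_add_eq_zero`: `n • (x • π Q + y • Q) = 0` (`n ≠ 0`, `Q` of infinite order) forces `x = y = 0`,
  because `4(2x² + xy + y²) = (x + 2y)² + 7x²` (apply `π` once more, `π² = π − 2`, eliminate `π Q`);
* §2 `not_dvd_of_levelData` (`p ∤ w` for level data at a level `N ≥ 1`); `exists_mk_eq_pow_smul_of_kummerMapLevel_eq_zero` (`κ_N(y) = 0 ⟹
  [y] ∈ p^N Λ`, `Λ = E(K)/tors`, via `exists_of_kummerMapLevel_eq_zero` and torsion-freeness); `eq_zero_of_forall_pow_dvd`;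
* §3 **`kummer_ind_of_not_isOfFinAddOrder`** — (IND) VERBATIM (hypothesis `hind` of p672752) with `P₁ := P₀`: if all those classes vanished,
  every `2 × 2` minor of the coordinates of `a = [π p^m P₀]`, `b = [p^m P₀]` in a `ℤ`-basis of `Λ` would be divisible by every `p^N`, hence `0`,
  so `a`, `b` would be `ℤ`-dependent — contradicting §1;
* §4 **`comap_kummer_le_ker_resOfLe_of_finite_conj_of_cyclic`** — (H1′) ⟸ `hfinB′` ∧ (T-loc at `v`) ∧ `IsUnit (r − r′)` ∧ `π² = π − 2` ∧ a
  `K`-point of infinite order: the CM input of the bottom value with NO analytic content left, only the local cyclicity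
  «`(E(K_v) ⊗ ℚ_p/ℤ_p)[p]` cyclic» (standard: `E(ℚ₂) ≅ ℤ₂ × finite`).

presearch: Mordell–Weil (Silverman VIII.6.7) is a tree theorem; the independence of `P`, `πP` for an endomorphism with `π² − π + 2 = 0` is
elementary; nothing to cite beyond the tree; no Literature fact filed.

References: [SilvermanAEC2009] VIII §2, VIII.6.7; [GreenbergLNM1716] §2; [Rubin1999] §2; [Agboola2007] §6.
-/

noncomputable section

open scoped Classical

set_option linter.dupNamespace false
set_option autoImplicit false

open NumberField IsDedekindDomain Field WeierstrassCurve
open Literature.NumberTheory.EllipticCurves Literature.NumberTheory.EllipticCurves.GreenbergSelmer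
open Literature.NumberTheory.EllipticCurves.Castella2018.AcSelmer
open Literature.NumberTheory.EllipticCurves.Agboola2007
open Literature.NumberTheory.EllipticCurves.ResKernel
open Literature.NumberTheory.GaloisRepresentations

universe u

namespace Summit.BirchSwinnertonDyer.BirchSwinnertonDyer.Theorems.PrintCf2.RestrictedSelmerPair

open Summit.BirchSwinnertonDyer.BirchSwinnertonDyer.Theorems.PrintCf2.CMPrimes

/-! ## §1. Independence of `Q` and `π Q` modulo torsion -/

section Independence

/-- `4 (2x² + xy + y²) = (x + 2y)² + 7x²`: the form `2x² + xy + y²` only vanishes at `x = y = 0`. [folklore] -/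
theorem eq_zero_of_quadForm_eq_zero {x y : ℤ} (h : 2 * x ^ 2 + x * y + y ^ 2 = 0) : x = 0 ∧ y = 0 := by
  have hx : x = 0 := by nlinarith [sq_nonneg (x + 2 * y), sq_nonneg x]
  subst hx
  have hy2 : y ^ 2 = 0 := by linarith
  exact ⟨rfl, pow_eq_zero_iff two_ne_zero |>.mp hy2⟩

variable {K : Type u} [Field K] (V : WeierstrassCurve K)

/-- **`π Q` and `Q` are independent modulo torsion** for an additive `π` with `π² = π − 2` and `Q` of infinite order: if
`n • (x • π Q + y • Q) = 0` with `n ≠ 0` then `x = y = 0`. Apply `π`: `n • ((x + y) • π Q − 2x • Q) = 0`; eliminate `π Q`: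
`n (2x² + xy + y²) • Q = 0`. [cite: SilvermanAEC2009, III §9] -/
theorem eq_zero_of_nsmul_zsmul_add_eq_zero {π : AddMonoid.End V.geomPoints} (hrel : π * π = π - 2) {Q : V.geomPoints}
    (hQ : ∀ n : ℤ, n • Q = 0 → n = 0) {n : ℕ} (hn : n ≠ 0) {x y : ℤ} (h : n • (x • π Q + y • Q) = 0) : x = 0 ∧ y = 0 := by
  have hππ : π (π Q) = π Q - 2 • Q := by
    have h := congrArg (fun f : AddMonoid.End V.geomPoints ↦ f Q) hrel
    have e : (π - 2 : AddMonoid.End V.geomPoints) Q = π Q - 2 • Q := by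
      change (π : V.geomPoints →+ V.geomPoints) Q - ((2 : AddMonoid.End V.geomPoints) : V.geomPoints →+ V.geomPoints) Q = _
      simp
    simpa [e] using h
  -- apply `π`
  have h2 : n • ((x + y) • π Q - (2 * x) • Q) = 0 := by
    have := congrArg π h
    rw [map_nsmul, map_add, map_zsmul, map_zsmul, hππ, map_zero] at this
    rw [← this]
    congr 1
    module
  -- eliminate `π Q`: `(x + y) •` (first) `− x •` (second)
  have h3 : ((n : ℤ) * (2 * x ^ 2 + x * y + y ^ 2)) • Q = 0 := by
    have e : ((n : ℤ) * (2 * x ^ 2 + x * y + y ^ 2)) • Q =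
        (x + y) • (n • (x • π Q + y • Q)) - x • (n • ((x + y) • π Q - (2 * x) • Q)) := by
      module
    rw [e, h, h2, smul_zero, smul_zero, sub_zero]
  have h4 := hQ _ h3
  rcases mul_eq_zero.mp h4 with h5 | h5
  · exact absurd (by exact_mod_cast h5) hn
  · exact eq_zero_of_quadForm_eq_zero h5

end Independence

/-! ## §2. Level data, Kummer kernel, and the free module `E(K)/tors` -/

section Tools

variable {K : Type u} [Field K] [NumberField K] (V : WeierstrassCurve K) [V.IsElliptic] (p : ℕ) [Fact p.Prime]

omit [NumberField K] [V.IsElliptic] in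
/-- For level data at a level `N ≥ 1`, `p ∤ w` (`w (N₁ − N₂) ≡ 1 (mod p^N)` and `1 ∉ pℤ_p`). [folklore] -/
theorem not_dvd_of_levelData {N : ℕ} (hN : 1 ≤ N) {N₁ N₂ w : ℤ}
    (hw : (((w * (N₁ - N₂) : ℤ) : ℤ_[p]) - 1) ∈ (Ideal.span {(p : ℤ_[p]) ^ N} : Ideal ℤ_[p])) : ¬ (p : ℤ) ∣ w := by
  rintro ⟨c, hc⟩
  have hle : (Ideal.span {(p : ℤ_[p]) ^ N} : Ideal ℤ_[p]) ≤ Ideal.span {(p : ℤ_[p])} :=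
    Ideal.span_singleton_le_span_singleton.mpr (dvd_pow_self _ (by omega))
  have h1 : (((w * (N₁ - N₂) : ℤ) : ℤ_[p])) ∈ (Ideal.span {(p : ℤ_[p])} : Ideal ℤ_[p]) := by
    rw [hc]; push_cast
    exact Ideal.mul_mem_right _ _ (Ideal.mul_mem_right _ _ (Ideal.mem_span_singleton_self _))
  have hone : (1 : ℤ_[p]) ∈ (Ideal.span {(p : ℤ_[p])} : Ideal ℤ_[p]) := by
    have := Ideal.sub_mem _ h1 (hle hw)
    rwa [sub_sub_cancel] at this
  rw [← PadicInt.maximalIdeal_eq_span_p] at hone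
  exact (IsLocalRing.maximalIdeal.isMaximal ℤ_[p]).ne_top (Ideal.eq_top_of_isUnit_mem _ hone isUnit_one)

/-- **`κ_N(y) = 0 ⟹ [y] ∈ p^N · (E(K)/tors)`** (`exists_of_kummerMapLevel_eq_zero`: `p^{m′} y = p^{N+m′} P₃`; cancel `p^{m′}` in the
torsion-free quotient). [cite: SilvermanAEC2009, VIII §2] -/
theorem exists_mk_eq_pow_smul_of_kummerMapLevel_eq_zero {N : ℕ} {y : V.toAffine.Point}
    (hy : V.kummerMapLevel p V.zsmul_geomPoints_surjective_holds N y = 0) :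
    ∃ P₃ : V.toAffine.Point, (QuotientAddGroup.mk y : mordellWeilModTorsion V) = p ^ N • QuotientAddGroup.mk P₃ := by
  obtain ⟨m', P₃, h⟩ := V.exists_of_kummerMapLevel_eq_zero p V.zsmul_geomPoints_surjective_holds N y hy
  refine ⟨P₃, nsmul_right_injective (pow_ne_zero m' (Fact.out : p.Prime).ne_zero) ?_⟩
  change p ^ m' • (QuotientAddGroup.mk y : mordellWeilModTorsion V) = p ^ m' • (p ^ N • QuotientAddGroup.mk P₃)
  rw [← QuotientAddGroup.mk_nsmul, h, pow_add, mul_comm, mul_smul, QuotientAddGroup.mk_nsmul, QuotientAddGroup.mk_nsmul]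

omit [NumberField K] [V.IsElliptic] [Fact p.Prime] in
/-- An integer divisible by every power of a prime is `0`. [folklore] -/
theorem eq_zero_of_forall_pow_dvd (hp : 1 < p) {D : ℤ} (h : ∀ N : ℕ, (p : ℤ) ^ N ∣ D) : D = 0 := by
  by_contra hD
  have hlt : D.natAbs < ((p : ℤ) ^ D.natAbs).natAbs := by
    rw [Int.natAbs_pow, Int.natAbs_natCast]
    exact Nat.lt_pow_self hp
  exact hD (Int.eq_zero_of_dvd_of_natAbs_lt_natAbs (h D.natAbs) hlt)

end Tools

/-! ## §3. (IND) from Mordell–Weil -/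

section Ind

variable {K : Type u} [Field K] [NumberField K] (V : WeierstrassCurve K) [V.IsElliptic] (p : ℕ) [Fact p.Prime]
  (π : V.endRing) (r r' : ℤ_[p])

/-- **(IND) from Mordell–Weil** — the hypothesis `hind` of `comap_kummer_le_ker_resOfLe_of_finite_conj_of_ind` (p672752), VERBATIM, for an
elliptic `V` over a number field, `π ∈ End_K(E)` with `π² = π − 2`, `2`-adic roots `r`, `r′` with `r − r′` a unit, and a `K`-point `P₀` of infinite
order: for every `m` there are a level `N`, level data `(N₁ ≡ r′, N₂ ≡ r, w)` and the descended point `P₂ = π(p^m P₀)` with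
`κ_N(w • (P₂ − N₂ • p^m P₀)) ≠ 0`. [cite: SilvermanAEC2009, VIII §2, VIII.6.7] [cite: GreenbergLNM1716, §2] -/
theorem kummer_ind_of_not_isOfFinAddOrder (hunit : IsUnit (r - r')) (hrel : (π : AddMonoid.End V.geomPoints) * π = π - 2)
    (P₀ : V.toAffine.Point) (hP₀ : ¬ IsOfFinAddOrder P₀) (m : ℕ) :
    ∃ (P₁ P₂ : V.toAffine.Point) (N : ℕ) (N₁ N₂ w : ℤ),
      ((N₁ : ℤ_[p]) - r') ∈ (Ideal.span {(p : ℤ_[p]) ^ N} : Ideal ℤ_[p]) ∧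
      ((N₂ : ℤ_[p]) - r) ∈ (Ideal.span {(p : ℤ_[p]) ^ N} : Ideal ℤ_[p]) ∧
      (((w * (N₁ - N₂) : ℤ) : ℤ_[p]) - 1) ∈ (Ideal.span {(p : ℤ_[p]) ^ N} : Ideal ℤ_[p]) ∧
      toGeomPoints V P₂ = (π : AddMonoid.End V.geomPoints) (toGeomPoints V (p ^ m • P₁)) ∧
      V.kummerMapLevel p V.zsmul_geomPoints_surjective_holds N (w • (P₂ - N₂ • (p ^ m • P₁))) ≠ 0 := by
  have hp : p.Prime := Fact.out
  obtain ⟨P₂, hP₂⟩ := exists_toGeomPoints_eq_endRing_apply V π (p ^ m • P₀)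
  -- level data at every level, for the conjugate pair `(r′, r)`
  have hunit' : IsUnit (r' - r) := by rw [← neg_sub]; exact hunit.neg
  have hdata := fun N : ℕ ↦ exists_proj_levelData p r' r hunit' N
  choose N₁ N₂ w hN₁ hN₂ hw using hdata
  by_contra hcon
  push Not at hcon
  have hκ : ∀ N : ℕ, V.kummerMapLevel p V.zsmul_geomPoints_surjective_holds N (w N • (P₂ - N₂ N • (p ^ m • P₀))) = 0 :=
    fun N ↦ hcon P₀ P₂ N (N₁ N) (N₂ N) (w N) (hN₁ N) (hN₂ N) (hw N) hP₂
  -- the free module `Λ = E(K)/tors` and the classes `a = [P₂]`, `b = [p^m P₀]`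
  haveI : Module.Free ℤ (mordellWeilModTorsion V) := module_free_mordellWeilModTorsion V (WeierstrassCurve.module_finite_point_holds V)
  set a : mordellWeilModTorsion V := QuotientAddGroup.mk P₂ with ha
  set b : mordellWeilModTorsion V := QuotientAddGroup.mk (p ^ m • P₀) with hb
  -- independence of `a`, `b`
  have hQ : ∀ n : ℤ, n • toGeomPoints V (p ^ m • P₀) = 0 → n = 0 := by
    intro n hn0
    by_contra hne
    apply hP₀
    have h1 : (n * ((p ^ m : ℕ) : ℤ)) • P₀ = 0 := toGeomPoints_injective V (by
      rw [map_zsmul, map_zero, mul_smul, natCast_zsmul, ← map_nsmul, hn0])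
    exact isOfFinAddOrder_iff_zsmul_eq_zero.mpr ⟨n * ((p ^ m : ℕ) : ℤ), mul_ne_zero hne (by exact_mod_cast pow_ne_zero m hp.ne_zero), h1⟩
  have hind : ∀ x y : ℤ, x • a + y • b = 0 → x = 0 ∧ y = 0 := by
    intro x y hxy
    have hmem : x • P₂ + y • (p ^ m • P₀) ∈ AddCommGroup.torsion V.toAffine.Point := by
      rw [← QuotientAddGroup.eq_zero_iff, QuotientAddGroup.mk_add, QuotientAddGroup.mk_zsmul, QuotientAddGroup.mk_zsmul]
      exact hxy
    obtain ⟨n, hn, hn0⟩ := (isOfFinAddOrder_iff_nsmul_eq_zero.mp ((AddCommGroup.mem_torsion _).mp hmem))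
    have hgeom : n • (x • (π : AddMonoid.End V.geomPoints) (toGeomPoints V (p ^ m • P₀)) + y • toGeomPoints V (p ^ m • P₀)) = 0 := by
      rw [← hP₂, ← map_zsmul, ← map_zsmul, ← map_add, ← map_nsmul, hn0, map_zero]
    exact eq_zero_of_nsmul_zsmul_add_eq_zero V hrel hQ hn.ne' hgeom
  -- coordinates in a `ℤ`-basis
  set B := Module.Free.chooseBasis ℤ (mordellWeilModTorsion V) with hB
  -- every `2 × 2` minor of `(a, b)` vanishes
  have hminor : ∀ i j, B.repr a i * B.repr b j - B.repr a j * B.repr b i = 0 := by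
    intro i j
    refine eq_zero_of_forall_pow_dvd p hp.one_lt fun N ↦ ?_
    -- level `N + 1`: `[w (a − N₂ b)] ∈ p^{N+1} Λ`, `p ∤ w`
    obtain ⟨P₃, hP₃⟩ := exists_mk_eq_pow_smul_of_kummerMapLevel_eq_zero V p (hκ (N + 1))
    have hcoord : ∀ k, (p : ℤ) ^ (N + 1) ∣ B.repr a k - N₂ (N + 1) * B.repr b k := by
      intro k
      have hk : w (N + 1) * (B.repr a k - N₂ (N + 1) * B.repr b k) = p ^ (N + 1) * B.repr (QuotientAddGroup.mk P₃) k := by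
        have hP₃' : w (N + 1) • (a - N₂ (N + 1) • b) = p ^ (N + 1) • (QuotientAddGroup.mk P₃ : mordellWeilModTorsion V) := by
          rw [ha, hb, ← QuotientAddGroup.mk_zsmul, ← QuotientAddGroup.mk_sub, ← QuotientAddGroup.mk_zsmul]
          exact hP₃
        have := congrArg (fun z ↦ B.repr z k) hP₃'
        simp only [map_zsmul, map_sub, map_nsmul, Finsupp.smul_apply, Finsupp.sub_apply, smul_eq_mul, nsmul_eq_mul] at this
        push_cast at this ⊢
        linear_combination this
      have hdvd : (p : ℤ) ^ (N + 1) ∣ w (N + 1) * (B.repr a k - N₂ (N + 1) * B.repr b k) := ⟨_, hk⟩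
      exact (Int.prime_iff_natAbs_prime.mpr (by simpa using hp)).pow_dvd_of_dvd_mul_left (N + 1)
        (not_dvd_of_levelData p (Nat.le_add_left 1 N) (hw (N + 1))) hdvd
    have e : B.repr a i * B.repr b j - B.repr a j * B.repr b i =
        (B.repr a i - N₂ (N + 1) * B.repr b i) * B.repr b j - (B.repr a j - N₂ (N + 1) * B.repr b j) * B.repr b i := by ring
    rw [e]
    exact (dvd_trans (pow_dvd_pow _ (Nat.le_succ N)) (Dvd.dvd.sub ((hcoord i).mul_right _) ((hcoord j).mul_right _)))
  -- `b ≠ 0`, pick a non-zero coordinate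
  have hb0 : b ≠ 0 := by
    intro h0
    have := (hind 0 1 (by rw [zero_smul, one_smul, zero_add, h0])).2
    exact one_ne_zero this
  obtain ⟨j, hj⟩ : ∃ j, B.repr b j ≠ 0 := by
    by_contra hall
    push Not at hall
    exact hb0 (B.repr.injective (by ext k; rw [hall k, map_zero, Finsupp.zero_apply]))
  -- `B_j • a − A_j • b = 0`, contradicting independence
  have hrel0 : B.repr b j • a + (-B.repr a j) • b = 0 := by
    apply B.repr.injective
    ext k
    rw [map_add, map_zsmul, map_zsmul, map_zero, Finsupp.add_apply, Finsupp.smul_apply, Finsupp.smul_apply, Finsupp.zero_apply,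
      smul_eq_mul, smul_eq_mul]
    linear_combination (-1 : ℤ) * hminor j k
  exact hj (hind _ _ hrel0).1

end Ind

/-! ## §4. (H1′) from `hfinB′` and the local cyclicity alone -/

section Assembly

variable {K : Type u} [Field K] [NumberField K] (V : WeierstrassCurve K) [V.IsElliptic] (p : ℕ) [Fact p.Prime]
  (π : V.endRing) (r r' : ℤ_[p]) (v : HeightOneSpectrum (𝓞 K))

/-- **(H1′) «`Q_M ≤ ker loc_v`» ⟸ `hfinB′` ∧ (T-loc).** On an imaginary quadratic base, for `π ∈ End_K(E)` with `π² = π − 2`, complementary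
eigen-summands with `r − r′` a unit and projectors `e`, `e′`, and a `K`-point of infinite order: the `W*`-components of the global Kummer classes
die at `v` as soon as `𝔖_v(K, W*′)` is finite and the Kummer image at `v` has cyclic `p`-torsion. (p671916 + p672752 + §3.)
[cite: Agboola2007, §6 (arXiv p0014:L5)] [cite: GreenbergLNM1716, §2 Prop. 2.1] -/
theorem comap_kummer_le_ker_resOfLe_of_finite_conj_of_cyclic (hK : IsImaginaryQuadratic K) (hunit : IsUnit (r - r'))
    (hrel : (π : AddMonoid.End V.geomPoints) * π = π - 2)
    (hinf : V.endEigenPrimaryTorsion p π r ⊓ V.endEigenPrimaryTorsion p π r' = ⊥)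
    (hsup : V.endEigenPrimaryTorsion p π r ⊔ V.endEigenPrimaryTorsion p π r' = ⊤)
    (e : V.geomPrimaryTorsion p →+ ↥(V.endEigenPrimaryTorsion p π r)) (e' : V.geomPrimaryTorsion p →+ ↥(V.endEigenPrimaryTorsion p π r'))
    (he₁ : ∀ x : ↥(V.endEigenPrimaryTorsion p π r), e x = x)
    (he : ∀ (σ : absoluteGaloisGroup K) (x : V.geomPrimaryTorsion p), e (σ • x) = σ • e x)
    (he'₁ : ∀ x : ↥(V.endEigenPrimaryTorsion p π r'), e' x = x) (he'₂ : ∀ x ∈ V.endEigenPrimaryTorsion p π r, e' x = 0)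
    (he' : ∀ (σ : absoluteGaloisGroup K) (x : V.geomPrimaryTorsion p), e' (σ • x) = σ • e' x)
    (hsum : ∀ x, (e x : V.geomPrimaryTorsion p) + (e' x : V.geomPrimaryTorsion p) = x)
    (P₀ : V.toAffine.Point) (hP₀ : ¬ IsOfFinAddOrder P₀)
    (hcyc : ∀ x ∈ (((V.kummerMapPInfty p V.zsmul_geomPoints_surjective_holds).range).map (resSubgroup ⊤ (V.geomPrimaryTorsion p))).map
        (resOfLe (V.geomPrimaryTorsion p) (inf_le_left : ⊤ ⊓ decomp v ≤ ⊤)),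
      ∀ y ∈ (((V.kummerMapPInfty p V.zsmul_geomPoints_surjective_holds).range).map (resSubgroup ⊤ (V.geomPrimaryTorsion p))).map
        (resOfLe (V.geomPrimaryTorsion p) (inf_le_left : ⊤ ⊓ decomp v ≤ ⊤)),
      p • x = 0 → p • y = 0 → x ≠ 0 → ∃ m : ℤ, y = m • x)
    (hfin' : Finite (restrictedSelmerBase ↥(V.endEigenPrimaryTorsion p π r') p v)) :
    (((V.kummerMapPInfty p V.zsmul_geomPoints_surjective_holds).range).map (resSubgroup ⊤ (V.geomPrimaryTorsion p))).comap
        (resH1Hom (ContinuousMonoidHom.id (⊤ : Subgroup (absoluteGaloisGroup K))) (V.endEigenPrimaryTorsion p π r).subtype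
          (fun _ _ ↦ rfl)) ≤
      (resOfLe ↥(V.endEigenPrimaryTorsion p π r) (inf_le_left : ⊤ ⊓ decomp v ≤ ⊤)).ker :=
  comap_kummer_le_ker_resOfLe_of_finite_conj_of_ind V p π r r' v hK hunit hinf hsup e e' he₁ he he'₁ he'₂ he' hsum
    (kummer_ind_of_not_isOfFinAddOrder V p π r r' hunit hrel P₀ hP₀) hcyc hfin'

end Assembly

end Summit.BirchSwinnertonDyer.BirchSwinnertonDyer.Theorems.PrintCf2.RestrictedSelmerPair

end
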